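import Summits.BirchSwinnertonDyer.BirchSwinnertonDyer.Theorems.ClassRecordThreeEulerHalvesAtThreeCartanSupplyCubicPointsFixedEigen
import Summits.BirchSwinnertonDyer.BirchSwinnertonDyer.Theorems.ClassRecordThreeEulerHalvesAtThreeCartanTorusCubeCutCyclic
import HarnessLib

/-!
# Fixed points on the cubic points, III: the cube-admissible rational eigenvalues by matrix type

Helper file `--supports stmt-BirchSwinnertonDyer-23422` (seat `bsd-stepL-tam3-p1` g23, LINE OWNER of crux 23422 `EulerHalvesAtThreeResidualUpperBound`,
line `cartan` v11), serving the registered stub (SUPPLY) `stub_cartanTorusLatticeSupply : CartanCorrespondence.CartanTorusLatticeSupply` via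
`HOME/tam3-p1/g23/SUPPLY-ROAD-GG1.md` §1–§2. Part II (`…CubicPointsFixedEigen`) gave, for non-scalar `g`, `E(g) = (q − 1)·R(g)` with
`R(g) = #{a ∈ 𝔽_q : a² + det g = tr g·a ∧ ∃ u, u³ det g = a²}` (cube-admissible rational eigenvalues). THIS FILE evaluates `R(g)`:
* `cube_iff_pow` (`q ≡ 1 (3)`): for `x ≠ 0`, `(∃ u, u³ = x) ↔ x^{(q−1)/3} = 1` (from bsd-idea-10 g11's `cyclic_cube_iff` in the unit group);
* `R(g) = 0` if `g` has no rational eigenvalue (`rootsCube_card_of_not_hasRatEigenvalue`);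
* `R(g) = 1` if `Δ = tr² − 4 det = 0` and `g` is not scalar: the double root `a = tr/2` has `a² = det`, `u = 1` (`rootsCube_card_of_discr_eq_zero`);
* for `Δ ≠ 0` with rational eigenvalues `λ ≠ μ`: the condition holds at both roots or at neither, according as `λ/μ` is a cube
  (`rootsCube_card_of_split` : `R(g) = 2·[∃ u, u³ μ = λ]`, any root labelling).
* §3 `card_cubicBorel` (`q ≡ 1 (3)`): `#cubicBorel q = q·(q−1)·((q−1)/3)` via the entry bijections `nonempty_cubicBorelEquiv`, `nonempty_pairCubeEquiv`
  and bsd-idea-10's `PS.card_cubeRoots`.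
(Part IV: `λ/μ` cube ⟺ `IsScalarMat (g^{(q−1)/3})` and the assembly `π_C − π_{ℙ¹} = 2χ_W`.)
HONEST FRAMING: finite-field counting; nothing about SUPPLY, NUM, crux 23422 ∕ 19109 is proved here; BSD is proved for no curve. [folklore]
-/

namespace Summit.BirchSwinnertonDyer.BirchSwinnertonDyer.Theorems.CartanSupply.CubicPointsFixed

open Summit.BirchSwinnertonDyer.BirchSwinnertonDyer.Theorems.CartanDegree
open Summit.BirchSwinnertonDyer.BirchSwinnertonDyer.Theorems.CartanTorusCubeCut
open Summit.BirchSwinnertonDyer.BirchSwinnertonDyer.Theorems.CartanSupply.CubicPoints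

set_option linter.dupNamespace false
set_option autoImplicit false

open scoped Classical

variable {q : ℕ} [Fact q.Prime]

/-! ## §1 Cubes in `𝔽_q^×` -/

/-- PROVED (`q ≡ 1 (mod 3)`): a non-zero `x ∈ 𝔽_q` is a cube iff `x^{(q−1)/3} = 1`. [folklore] -/
theorem cube_iff_pow (h1 : q % 3 = 1) {x : ZMod q} (hx : x ≠ 0) :
    (∃ u : ZMod q, u ^ 3 = x) ↔ x ^ ((q - 1) / 3) = 1 := by
  have hcard : Fintype.card (ZMod q)ˣ = q - 1 := ZMod.card_units q
  have h3 : 3 ∣ Fintype.card (ZMod q)ˣ := by rw [hcard]; omega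
  have key := cyclic_cube_iff h3 (Units.mk0 x hx)
  rw [hcard] at key
  constructor
  · rintro ⟨u, rfl⟩
    have hu : u ≠ 0 := by rintro rfl; exact hx (by simp)
    have : (∃ y : (ZMod q)ˣ, y ^ 3 = Units.mk0 (u ^ 3) hx) := ⟨Units.mk0 u hu, Units.ext (by simp)⟩
    have h := key.mp this
    have := congrArg (fun z : (ZMod q)ˣ => (z : ZMod q)) h
    simpa using this
  · intro h
    have hk : (Units.mk0 x hx) ^ ((q - 1) / 3) = 1 := Units.ext (by simpa using h)
    obtain ⟨y, hy⟩ := key.mpr hk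
    refine ⟨(y : ZMod q), ?_⟩
    have := congrArg (fun z : (ZMod q)ˣ => (z : ZMod q)) hy
    simpa using this

/-! ## §2 `R(g)` by type -/

/-- PROVED: no rational eigenvalue ⇒ `R(g) = 0`. [folklore] -/
theorem rootsCube_card_of_not_hasRatEigenvalue (M : Mat q) (h : ¬ HasRatEigenvalue M) :
    (Finset.univ.filter fun a : ZMod q => a * a + M.det = M.trace * a ∧ ∃ u : ZMod q, u ^ 3 * M.det = a ^ 2).card = 0 := by
  rw [Finset.card_eq_zero, Finset.filter_eq_empty_iff]
  rintro a - ⟨ha, -⟩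
  exact h ⟨a, ha⟩

/-- PROVED (`q` odd): a double root (`Δ = 0`) is `a = tr/2` with `a² = det`, so the cube condition holds with `u = 1`: `R(g) = 1`. [folklore] -/
theorem rootsCube_card_of_discr_eq_zero (h2 : (2 : ZMod q) ≠ 0) (M : Mat q) (hΔ : M.trace ^ 2 - 4 * M.det = 0) :
    (Finset.univ.filter fun a : ZMod q => a * a + M.det = M.trace * a ∧ ∃ u : ZMod q, u ^ 3 * M.det = a ^ 2).card = 1 := by
  -- the cube condition is automatic at the double root, so this is `rootCount M = 1`
  have hroot : ∀ a : ZMod q, a * a + M.det = M.trace * a → ∃ u : ZMod q, u ^ 3 * M.det = a ^ 2 := by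
    intro a ha
    refine ⟨1, ?_⟩
    -- `(2a − tr)² = tr² − 4 det = 0` ⇒ `2a = tr` ⇒ `a² = det`
    have hsq : (2 * a - M.trace) ^ 2 = 0 := by
      have : (2 * a - M.trace) ^ 2 = M.trace ^ 2 - 4 * M.det := by linear_combination (4 : ZMod q) * ha
      rw [this, hΔ]
    have h2a : 2 * a = M.trace := by
      have := pow_eq_zero_iff (n := 2) (by norm_num) |>.mp hsq
      exact sub_eq_zero.mp this
    have : a * a = M.det := by
      have h4 : (2 : ZMod q) * 2 ≠ 0 := mul_ne_zero h2 h2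
      apply mul_left_cancel₀ h4
      linear_combination (4 * a) * h2a - (4 : ZMod q) * ha
    rw [one_pow, one_mul, sq, this]
  have : (Finset.univ.filter fun a : ZMod q => a * a + M.det = M.trace * a ∧ ∃ u : ZMod q, u ^ 3 * M.det = a ^ 2) =
      Finset.univ.filter fun a : ZMod q => a * a + M.det = M.trace * a := by
    apply Finset.filter_congr
    intro a _
    exact ⟨fun h => h.1, fun h => ⟨h, hroot a h⟩⟩
  rw [this]
  exact rootCount_of_disc_eq_zero h2 hΔ

/-- PROVED: for a root `λ` of `x² − tr·x + det` with `det ≠ 0`... the other root is `μ = tr − λ` with `λ μ = det`; the cube condition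
`∃ u, u³ det = λ²` is `∃ u, u³ μ = λ`. [folklore] -/
theorem cube_cond_iff_ratio {M : Mat q} {l : ZMod q} (hl : l * l + M.det = M.trace * l) (hl0 : l ≠ 0) :
    (∃ u : ZMod q, u ^ 3 * M.det = l ^ 2) ↔ ∃ u : ZMod q, u ^ 3 * (M.trace - l) = l := by
  have hdet : M.det = l * (M.trace - l) := by linear_combination hl
  rw [hdet]
  constructor
  · rintro ⟨u, hu⟩
    refine ⟨u, mul_left_cancel₀ hl0 ?_⟩
    linear_combination hu
  · rintro ⟨u, hu⟩
    exact ⟨u, by linear_combination l * hu⟩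

/-- PROVED — **TWO RATIONAL EIGENVALUES**: if `λ ≠ μ` are the roots (`λ + μ = tr`, `λ μ = det`), the cube condition holds at both or at neither:
`R(g) = 2·[∃ u, u³ μ = λ]`. [folklore] -/
theorem rootsCube_card_of_split (M : Mat q) {l m : ZMod q} (hlm : l ≠ m) (hsum : l + m = M.trace) (hprod : l * m = M.det)
    (hdet : M.det ≠ 0) :
    (Finset.univ.filter fun a : ZMod q => a * a + M.det = M.trace * a ∧ ∃ u : ZMod q, u ^ 3 * M.det = a ^ 2).card =
      if ∃ u : ZMod q, u ^ 3 * m = l then 2 else 0 := by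
  have hl0 : l ≠ 0 := fun h => hdet (by rw [← hprod, h, zero_mul])
  have hm0 : m ≠ 0 := fun h => hdet (by rw [← hprod, h, mul_zero])
  -- the roots are exactly `l` and `m`
  have hroots : ∀ a : ZMod q, a * a + M.det = M.trace * a ↔ a = l ∨ a = m := by
    intro a
    constructor
    · intro ha
      have : (a - l) * (a - m) = 0 := by linear_combination ha - a * hsum + hprod
      rcases mul_eq_zero.mp this with h | h
      · exact Or.inl (sub_eq_zero.mp h)
      · exact Or.inr (sub_eq_zero.mp h)
    · rintro (rfl | rfl)
      · linear_combination a * hsum - hprod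
      · linear_combination a * hsum - hprod
  -- the cube condition at `l` is `∃ u, u³ m = l`, at `m` it is `∃ u, u³ l = m`, and these are equivalent
  have hCl : (∃ u : ZMod q, u ^ 3 * M.det = l ^ 2) ↔ ∃ u : ZMod q, u ^ 3 * m = l := by
    have hl : l * l + M.det = M.trace * l := (hroots l).mpr (Or.inl rfl)
    rw [cube_cond_iff_ratio hl hl0, show M.trace - l = m by linear_combination -hsum]
  have hCm : (∃ u : ZMod q, u ^ 3 * M.det = m ^ 2) ↔ ∃ u : ZMod q, u ^ 3 * m = l := by
    have hm : m * m + M.det = M.trace * m := (hroots m).mpr (Or.inr rfl)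
    rw [cube_cond_iff_ratio hm hm0, show M.trace - m = l by linear_combination -hsum]
    constructor
    · rintro ⟨u, hu⟩
      have hu0 : u ≠ 0 := by rintro rfl; exact hm0 (by rw [← hu]; ring)
      refine ⟨u⁻¹, ?_⟩
      rw [← hu]; field_simp
    · rintro ⟨u, hu⟩
      have hu0 : u ≠ 0 := by rintro rfl; exact hl0 (by rw [← hu]; ring)
      refine ⟨u⁻¹, ?_⟩
      rw [← hu]; field_simp
  by_cases hC : ∃ u : ZMod q, u ^ 3 * m = l
  · rw [if_pos hC]
    have : (Finset.univ.filter fun a : ZMod q => a * a + M.det = M.trace * a ∧ ∃ u : ZMod q, u ^ 3 * M.det = a ^ 2) = {l, m} := by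
      ext a
      simp only [Finset.mem_filter, Finset.mem_univ, true_and, Finset.mem_insert, Finset.mem_singleton, hroots]
      constructor
      · exact fun h => h.1
      · rintro (rfl | rfl)
        · exact ⟨Or.inl rfl, hCl.mpr hC⟩
        · exact ⟨Or.inr rfl, hCm.mpr hC⟩
    rw [this, Finset.card_pair hlm]
  · rw [if_neg hC, Finset.card_eq_zero, Finset.filter_eq_empty_iff]
    rintro a - ⟨ha, hcube⟩
    rcases (hroots a).mp ha with rfl | rfl
    · exact hC (hCl.mp hcube)
    · exact hC (hCm.mp hcube)

/-! ## §3 The order of the cubic Borel subgroup -/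

/-- PROVED: an element of the cubic Borel subgroup is the upper-triangular matrix of its three entries; these give a bijection with
`{(a, b, d) ∈ 𝔽_q^× × 𝔽_q × 𝔽_q^× : ∃ u, u³ d = a}`. [folklore] -/
theorem nonempty_cubicBorelEquiv :
    Nonempty ((cubicBorel q) ≃ {t : (ZMod q)ˣ × ZMod q × (ZMod q)ˣ // ∃ u : ZMod q, u ^ 3 * (t.2.2 : ZMod q) = t.1}) :=
  ⟨{ toFun := fun g => ⟨(Units.mk0 ((g.1 : Mat q) 0 0) (diag_ne_zero_of_upper g.1 g.2.1).1, (g.1 : Mat q) 0 1,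
        Units.mk0 ((g.1 : Mat q) 1 1) (diag_ne_zero_of_upper g.1 g.2.1).2), by simpa using g.2.2⟩
     invFun := fun t => ⟨Matrix.GeneralLinearGroup.mkOfDetNeZero !![(t.1.1 : ZMod q), t.1.2.1; 0, (t.1.2.2 : ZMod q)]
        (by rw [Matrix.det_fin_two_of]; simp [t.1.1.ne_zero, t.1.2.2.ne_zero]), by
        refine ⟨by simp [Matrix.GeneralLinearGroup.mkOfDetNeZero], ?_⟩
        obtain ⟨u, hu⟩ := t.2
        exact ⟨u, by simpa [Matrix.GeneralLinearGroup.mkOfDetNeZero] using hu⟩⟩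
     left_inv := fun g => by
       apply Subtype.ext
       apply Units.ext
       ext i j
       fin_cases i <;> fin_cases j
       · simp [Matrix.GeneralLinearGroup.mkOfDetNeZero]
       · simp [Matrix.GeneralLinearGroup.mkOfDetNeZero]
       · simp [Matrix.GeneralLinearGroup.mkOfDetNeZero, g.2.1]
       · simp [Matrix.GeneralLinearGroup.mkOfDetNeZero]
     right_inv := fun t => by
       apply Subtype.ext
       ext <;> simp [Matrix.GeneralLinearGroup.mkOfDetNeZero] }⟩

/-- PROVED: pairs `(a, d)` of units with `a/d` a cube correspond to pairs (cube `c`, unit `d`) via `a = c d` (`q ≡ 1 (3)`). [folklore] -/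
theorem nonempty_pairCubeEquiv (h1 : q % 3 = 1) :
    Nonempty ({p : (ZMod q)ˣ × (ZMod q)ˣ // ∃ u : ZMod q, u ^ 3 * (p.2 : ZMod q) = p.1} ≃
      {c : (ZMod q)ˣ // (c : ZMod q) ^ ((q - 1) / 3) = 1} × (ZMod q)ˣ) :=
  ⟨{ toFun := fun p => (⟨p.1.1 * p.1.2⁻¹, by
        obtain ⟨u, hu⟩ := p.2
        have hc : ∃ v : ZMod q, v ^ 3 = ((p.1.1 * p.1.2⁻¹ : (ZMod q)ˣ) : ZMod q) := by
          refine ⟨u, ?_⟩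
          rw [Units.val_mul, ← hu, Units.val_inv_eq_inv_val]
          field_simp
        exact (cube_iff_pow h1 (Units.ne_zero _)).mp hc⟩, p.1.2)
     invFun := fun cd => ⟨(cd.1.1 * cd.2, cd.2), by
        obtain ⟨v, hv⟩ := (cube_iff_pow h1 (Units.ne_zero cd.1.1)).mpr cd.1.2
        exact ⟨v, by rw [Units.val_mul, ← hv]⟩⟩
     left_inv := fun p => by
       apply Subtype.ext
       ext <;> simp
     right_inv := fun cd => by
       ext <;> simp }⟩

/-- PROVED — **THE ORDER OF THE CUBIC BOREL SUBGROUP** (`q ≡ 1 (mod 3)`): `#H = q · (q − 1) · ((q − 1)/3)`. [folklore] -/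
theorem card_cubicBorel (h1 : q % 3 = 1) : Nat.card (cubicBorel q) = q * ((q - 1) / 3 * (q - 1)) := by
  -- triples `(a, b, d)` ↦ `b` and the pair `(a, d)`
  let e1 : {t : (ZMod q)ˣ × ZMod q × (ZMod q)ˣ // ∃ u : ZMod q, u ^ 3 * (t.2.2 : ZMod q) = t.1} ≃
      ZMod q × {p : (ZMod q)ˣ × (ZMod q)ˣ // ∃ u : ZMod q, u ^ 3 * (p.2 : ZMod q) = p.1} :=
    { toFun := fun t => (t.1.2.1, ⟨(t.1.1, t.1.2.2), t.2⟩)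
      invFun := fun bp => ⟨(bp.2.1.1, bp.1, bp.2.1.2), bp.2.2⟩
      left_inv := fun t => by apply Subtype.ext; rfl
      right_inv := fun bp => by rfl }
  obtain ⟨e0⟩ := nonempty_cubicBorelEquiv (q := q)
  obtain ⟨e2⟩ := nonempty_pairCubeEquiv h1
  rw [Nat.card_congr e0, Nat.card_congr e1, Nat.card_prod, Nat.card_congr e2, Nat.card_prod,
    Nat.card_eq_fintype_card (α := ZMod q), ZMod.card, Nat.card_eq_fintype_card (α := (ZMod q)ˣ), ZMod.card_units,
    Nat.card_eq_fintype_card, Fintype.card_subtype, PS.card_cubeRoots h1]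

end Summit.BirchSwinnertonDyer.BirchSwinnertonDyer.Theorems.CartanSupply.CubicPointsFixed
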